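import Summits.AtomisticToContinuum.HydrodynamicLimit.Theorems.OneFlightGossipEngineEquilibriumClampedCollisionalWindowLDAdaptedClampKinematics

/-!
# Record kinematics on good orbits (stub `stub_collisionDecomposition`, line `radial-virial-polarization`)

Helper file (`--supports stmt-AtomisticToContinuum-13733`) for the registered stub `stub_collisionDecomposition` (S5) of
the line `radial-virial-polarization` of the crux `EquilibriumClampedCollisionalWindowLD` (repaired statement
`ClampedTransferCoin.RadialVirial.ClampedTransferWindowLD`), over the landed vocabulary
`…EquilibriumClampedCollisionalWindowLDDefs` (`Phase`, `Rec`, `impulse`, `payload`). The ONE-RECORD facts about a record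
`c = ofConfig (Torus.geometry (Fin 3)) ε x t i j` read off an ordered contact pair `(i, j)`:

* `fstPos_sub_proj_sepVec` — on the torus `x_snd = x_fst - proj (sepVec x_fst x_snd)` (`proj ∘ reprSym = id`);
* `sepVec_eq_smul_impactVec` — `sepVec = ε • ω̂` (`ω̂ = impactVec = ε⁻¹ • sepVec`), and `‖ω̂‖ = 1` at contact;
* `postVel_fst_sub_preVel_fst` — along a hard-sphere trajectory the velocity jump of the first partner is RADIAL AND
  OUTGOING: `v_fst⁺ - v_fst⁻ = ‖v_fst⁺ - v_fst⁻‖ • ω̂` (elastic law `v⁺ - v⁻ = (⟪v_i - v_j, n⟫/‖n‖²) n` with the outgoing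
  sign `0 < ⟪n, v_i⁺ - v_j⁺⟫`, `IsHardSphereTrajectory.inner_sepVec_postVel_pos`);
* `energy_jump_eq` — `(‖v⁺‖² - ‖v⁻‖²)/2 = ‖v⁺ - v⁻‖ · ∑ l, (½(v_fst⁺ + v_snd⁺))_l ω̂_l` (pair momentum conservation);
* `abs_payload_sub_le` — given a second-order Taylor bound `|φ x - φ (x - proj v) - ∑ ∂_lφ(x) v_l| ≤ C₂‖v‖²`, every row's
  payload is `ε ×` the radial-virial weight `× ‖Δv‖` up to `C₂ ε² · impulse c`:
  momentum `k`: `|payload_k - ε ⟨∇φ, ω̂⟩ ω̂_k ‖Δv‖| ≤ C₂ ε² impulse`, energy: `|payload_e - ε ⟨∇φ,ω̂⟩⟨V_cm,ω̂⟩‖Δv‖| ≤ C₂ ε² impulse`.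

Registered sub-goal anchoring the file: `collisionDecomposition_radial_jump`.
-/

noncomputable section

open MeasureTheory Set Filter
open scoped ENNReal BigOperators InnerProductSpace
open Literature.Analysis.FluidPDE Literature.MathematicalPhysics.KineticTheory
open Literature.Analysis.FunctionSpaces (Torus.partialDeriv Torus.IsSmooth)

namespace Summit.AtomisticToContinuum.HydrodynamicLimit.Theorems.ClampedTransferCoin

namespace RadialVirial

namespace CollisionDecomposition

open HardSphereCollisionRecord
open Literature.Analysis.FunctionSpaces (Torus.proj)

variable {N : ℕ}

/-! ### Geometry of a contact record on the torus -/

/-- On the torus the second position of a record is the first minus the projected separation vector: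
`x_fst - proj (sepVec x_fst x_snd) = x_snd` (`sepVec x y = reprSym (x - y)`, `proj (reprSym u) = u`). -/
theorem fstPos_sub_proj_sepVec (ε : ℝ) (x : Phase N) (t : ℝ) (i j : Fin (N + 1)) :
    (ofConfig (Torus.geometry (Fin 3)) ε x t i j).fstPos -
        Torus.proj ((Torus.geometry (Fin 3)).sepVec (x i).1 (x j).1) =
      (ofConfig (Torus.geometry (Fin 3)) ε x t i j).sndPos := by
  rw [ofConfig_fstPos, ofConfig_sndPos, Torus.geometry_sepVec, Torus.proj_reprSym, sub_sub_cancel]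

/-- The separation vector is `ε` times the impact vector (`ε ≠ 0`). -/
theorem sepVec_eq_smul_impactVec {ε : ℝ} (hε : ε ≠ 0) (x : Phase N) (t : ℝ) (i j : Fin (N + 1)) :
    (Torus.geometry (Fin 3)).sepVec (x i).1 (x j).1 =
      ε • (ofConfig (Torus.geometry (Fin 3)) ε x t i j).impactVec := by
  rw [ofConfig_impactVec, smul_smul, mul_inv_cancel₀ hε, one_smul]

/-- At contact the impact vector is a unit vector. -/
theorem norm_impactVec_eq_one {ε : ℝ} (hε : 0 < ε) {x : Phase N} (t : ℝ) {p : Fin (N + 1) × Fin (N + 1)}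
    (hp : p ∈ contactPairs (Torus.geometry (Fin 3)) ε x) :
    ‖(ofConfig (Torus.geometry (Fin 3)) ε x t p.1 p.2).impactVec‖ = 1 :=
  norm_ofConfig_impactVec hε t (mem_contactPairs.1 hp).2

/-! ### The radial, outgoing velocity jump and the energy jump along a hard-sphere trajectory -/

section Trajectory

variable {ε : ℝ} {γ : ℝ → Phase N} {t : ℝ} {p : Fin (N + 1) × Fin (N + 1)}

/-- **Radial outgoing jump.** Along a hard-sphere trajectory, at an ordered contact pair `p = (i, j)`:
`v_i⁺ - v_i⁻ = ‖v_i⁺ - v_i⁻‖ • ω̂` (the jump is `(⟪v_i - v_j, n⟫/‖n‖²) n` with `⟪v_i - v_j, n⟫ > 0` after the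
collision, and `n = ε ω̂`, `‖n‖ = ε`). -/
theorem postVel_fst_sub_preVel_fst (hε : 0 < ε)
    (hγ : IsHardSphereTrajectory (Torus.geometry (Fin 3)) ε (N + 1) γ)
    (hp : p ∈ contactPairs (Torus.geometry (Fin 3)) ε (γ t)) :
    (ofConfig (Torus.geometry (Fin 3)) ε (γ t) t p.1 p.2).postVel.1 -
        (ofConfig (Torus.geometry (Fin 3)) ε (γ t) t p.1 p.2).preVel.1 =
      ‖(ofConfig (Torus.geometry (Fin 3)) ε (γ t) t p.1 p.2).postVel.1 -
          (ofConfig (Torus.geometry (Fin 3)) ε (γ t) t p.1 p.2).preVel.1‖ •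
        (ofConfig (Torus.geometry (Fin 3)) ε (γ t) t p.1 p.2).impactVec := by
  set n := (Torus.geometry (Fin 3)).sepVec (γ t p.1).1 (γ t p.2).1 with hn
  have hnorm : ‖n‖ = ε := (mem_contactSet.1 (mem_contactPairs.1 hp).2).2
  set lam := ⟪(γ t p.1).2 - (γ t p.2).2, n⟫_ℝ / ‖n‖ ^ 2 with hlam
  have hjump : (ofConfig (Torus.geometry (Fin 3)) ε (γ t) t p.1 p.2).postVel.1 -
      (ofConfig (Torus.geometry (Fin 3)) ε (γ t) t p.1 p.2).preVel.1 = lam • n := by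
    simp only [ofConfig_postVel, ofConfig_preVel, reflectVel]
    rw [sub_sub_cancel]
  have hp' : (p.1, p.2) ∈ contactPairs (Torus.geometry (Fin 3)) ε (γ t) := by simpa only [Prod.mk.eta] using hp
  have hpos := hγ.inner_sepVec_postVel_pos hp'
  simp only [ofConfig_postVel] at hpos
  have hlam0 : 0 ≤ lam := div_nonneg (by rw [real_inner_comm]; exact hpos.le) (sq_nonneg _)
  rw [hjump, norm_smul, Real.norm_eq_abs, abs_of_nonneg hlam0, hnorm, ofConfig_impactVec, smul_smul,
    mul_assoc, mul_inv_cancel₀ hε.ne', mul_one]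

/-- Componentwise radial jump: `(v_i⁺ - v_i⁻)_k = ‖v_i⁺ - v_i⁻‖ ω̂_k`. -/
theorem postVel_fst_sub_preVel_fst_apply (hε : 0 < ε)
    (hγ : IsHardSphereTrajectory (Torus.geometry (Fin 3)) ε (N + 1) γ)
    (hp : p ∈ contactPairs (Torus.geometry (Fin 3)) ε (γ t)) (k : Fin 3) :
    (ofConfig (Torus.geometry (Fin 3)) ε (γ t) t p.1 p.2).postVel.1 k -
        (ofConfig (Torus.geometry (Fin 3)) ε (γ t) t p.1 p.2).preVel.1 k =
      ‖(ofConfig (Torus.geometry (Fin 3)) ε (γ t) t p.1 p.2).postVel.1 -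
          (ofConfig (Torus.geometry (Fin 3)) ε (γ t) t p.1 p.2).preVel.1‖ *
        (ofConfig (Torus.geometry (Fin 3)) ε (γ t) t p.1 p.2).impactVec k := by
  have h := congrArg (fun v : V3 => v k) (postVel_fst_sub_preVel_fst hε hγ hp)
  simpa only [PiLp.sub_apply, PiLp.smul_apply, smul_eq_mul] using h

/-- **Energy jump.** `(‖v_i⁺‖² - ‖v_i⁻‖²)/2 = ‖v_i⁺ - v_i⁻‖ · ∑ l, (½(v_i⁺ + v_j⁺))_l ω̂_l`: the energy jump is
`⟪Δv, v_i⁺ + v_j⁺⟫ / 2` (elastic law; pair momentum is conserved) with `Δv = ‖Δv‖ ω̂`. -/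
theorem energy_jump_eq (hε : 0 < ε)
    (hγ : IsHardSphereTrajectory (Torus.geometry (Fin 3)) ε (N + 1) γ)
    (hp : p ∈ contactPairs (Torus.geometry (Fin 3)) ε (γ t)) :
    (‖(ofConfig (Torus.geometry (Fin 3)) ε (γ t) t p.1 p.2).postVel.1‖ ^ 2 -
          ‖(ofConfig (Torus.geometry (Fin 3)) ε (γ t) t p.1 p.2).preVel.1‖ ^ 2) / 2 =
      ‖(ofConfig (Torus.geometry (Fin 3)) ε (γ t) t p.1 p.2).postVel.1 -
          (ofConfig (Torus.geometry (Fin 3)) ε (γ t) t p.1 p.2).preVel.1‖ *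
        ∑ l, ((2 : ℝ)⁻¹ • ((ofConfig (Torus.geometry (Fin 3)) ε (γ t) t p.1 p.2).postVel.1 +
            (ofConfig (Torus.geometry (Fin 3)) ε (γ t) t p.1 p.2).postVel.2)) l *
          (ofConfig (Torus.geometry (Fin 3)) ε (γ t) t p.1 p.2).impactVec l := by
  set c := ofConfig (Torus.geometry (Fin 3)) ε (γ t) t p.1 p.2 with hc
  -- energy jump as an inner product with the jump: `‖v⁺‖² - ‖v⁻‖² = ⟪v⁺ - v⁻, v_i⁺ + v_j⁺⟫`
  have hE : ‖c.postVel.1‖ ^ 2 - ‖c.preVel.1‖ ^ 2 = ⟪c.postVel.1 - c.preVel.1, c.postVel.1 + c.postVel.2⟫_ℝ := by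
    have hpre : c.preVel = reflectVel ((Torus.geometry (Fin 3)).sepVec (γ t p.1).1 (γ t p.2).1) c.postVel := by
      simp only [hc, ofConfig_preVel, ofConfig_postVel]
    set nn := (Torus.geometry (Fin 3)).sepVec (γ t p.1).1 (γ t p.2).1
    rw [hpre]
    set q := c.postVel
    set β := ⟪q.1 - q.2, nn⟫_ℝ / ‖nn‖ ^ 2
    have hβ : β * ‖nn‖ ^ 2 = ⟪nn, q.1⟫_ℝ - ⟪nn, q.2⟫_ℝ := by
      by_cases hnn : nn = 0
      · simp [β, hnn]
      · rw [← inner_sub_right, ← real_inner_comm nn (q.1 - q.2)]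
        exact div_mul_cancel₀ _ (pow_ne_zero 2 (norm_ne_zero_iff.2 hnn))
    have h1 : (reflectVel nn q).1 = q.1 - β • nn := rfl
    rw [h1, sub_sub_cancel, norm_sub_sq_real, real_inner_smul_left, real_inner_smul_right, norm_smul, mul_pow,
      Real.norm_eq_abs, sq_abs, inner_add_right, real_inner_comm nn q.1]
    linear_combination (-β) * hβ
  rw [postVel_fst_sub_preVel_fst hε hγ hp, real_inner_smul_left] at hE
  rw [hE, mul_div_assoc]
  congr 1
  simp only [PiLp.inner_apply, RCLike.inner_apply, conj_trivial, PiLp.smul_apply, PiLp.add_apply, smul_eq_mul,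
    Finset.sum_div]
  exact Finset.sum_congr rfl fun l _ => by ring

end Trajectory

/-! ### The payload of every row is `ε ×` its radial-virial weight `× ‖Δv‖` up to `C₂ ε² · impulse` -/

/-- The momentum part of the impulse bounds the jump, the energy part bounds the energy jump. -/
theorem norm_sub_le_impulse (c : Rec N) : ‖c.postVel.1 - c.preVel.1‖ ≤ impulse c := by
  unfold impulse; exact le_add_of_nonneg_right (by positivity)

/-- The energy part of the impulse bounds the absolute energy jump. -/
theorem abs_energy_le_impulse (c : Rec N) : |‖c.postVel.1‖ ^ 2 - ‖c.preVel.1‖ ^ 2| / 2 ≤ impulse c := by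
  unfold impulse; exact le_add_of_nonneg_left (norm_nonneg _)

/-- **Per-record polarisation with Taylor remainder.** Given the second-order Taylor bound
`|φ x - φ (x - proj v) - ∑ l, ∂_lφ(x) v_l| ≤ C₂ ‖v‖²` of `φ`, at every ordered contact pair of a hard-sphere trajectory on
`𝕋³` (diameter `ε > 0`) the momentum-`k` payload is `ε ⟨∇φ(x_fst), ω̂⟩ ω̂_k ‖Δv‖` and the energy payload is
`ε ⟨∇φ(x_fst), ω̂⟩ ⟨½(v_fst⁺ + v_snd⁺), ω̂⟩ ‖Δv‖`, each up to `C₂ ε² · impulse`. -/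
theorem abs_payload_sub_le {φ : T3 → ℝ} {C₂ : ℝ}
    (hT : ∀ (x : T3) (v : V3), |φ x - φ (x - Torus.proj v) - ∑ l, Torus.partialDeriv l φ x * v l| ≤ C₂ * ‖v‖ ^ 2)
    {ε : ℝ} (hε : 0 < ε) {γ : ℝ → Phase N} (hγ : IsHardSphereTrajectory (Torus.geometry (Fin 3)) ε (N + 1) γ)
    {t : ℝ} {p : Fin (N + 1) × Fin (N + 1)} (hp : p ∈ contactPairs (Torus.geometry (Fin 3)) ε (γ t)) :
    (∀ k : Fin 3,
      |payload φ (some k) (ofConfig (Torus.geometry (Fin 3)) ε (γ t) t p.1 p.2) -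
          ε * ((∑ l, Torus.partialDeriv l φ (ofConfig (Torus.geometry (Fin 3)) ε (γ t) t p.1 p.2).fstPos *
                (ofConfig (Torus.geometry (Fin 3)) ε (γ t) t p.1 p.2).impactVec l) *
              (ofConfig (Torus.geometry (Fin 3)) ε (γ t) t p.1 p.2).impactVec k *
            ‖(ofConfig (Torus.geometry (Fin 3)) ε (γ t) t p.1 p.2).postVel.1 -
                (ofConfig (Torus.geometry (Fin 3)) ε (γ t) t p.1 p.2).preVel.1‖)| ≤
        C₂ * ε ^ 2 * impulse (ofConfig (Torus.geometry (Fin 3)) ε (γ t) t p.1 p.2)) ∧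
    |payload φ none (ofConfig (Torus.geometry (Fin 3)) ε (γ t) t p.1 p.2) -
        ε * ((∑ l, Torus.partialDeriv l φ (ofConfig (Torus.geometry (Fin 3)) ε (γ t) t p.1 p.2).fstPos *
              (ofConfig (Torus.geometry (Fin 3)) ε (γ t) t p.1 p.2).impactVec l) *
            (∑ l, ((2 : ℝ)⁻¹ • ((ofConfig (Torus.geometry (Fin 3)) ε (γ t) t p.1 p.2).postVel.1 +
                (ofConfig (Torus.geometry (Fin 3)) ε (γ t) t p.1 p.2).postVel.2)) l *
              (ofConfig (Torus.geometry (Fin 3)) ε (γ t) t p.1 p.2).impactVec l) *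
          ‖(ofConfig (Torus.geometry (Fin 3)) ε (γ t) t p.1 p.2).postVel.1 -
              (ofConfig (Torus.geometry (Fin 3)) ε (γ t) t p.1 p.2).preVel.1‖)| ≤
      C₂ * ε ^ 2 * impulse (ofConfig (Torus.geometry (Fin 3)) ε (γ t) t p.1 p.2) := by
  set c := ofConfig (Torus.geometry (Fin 3)) ε (γ t) t p.1 p.2 with hc
  set A := ∑ l, Torus.partialDeriv l φ c.fstPos * c.impactVec l with hA
  -- the Taylor remainder of `φ(x_fst) - φ(x_snd)`
  set R := φ c.fstPos - φ c.sndPos - ε * A with hR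
  have hRle : |R| ≤ C₂ * ε ^ 2 := by
    have h := hT c.fstPos ((Torus.geometry (Fin 3)).sepVec (γ t p.1).1 (γ t p.2).1)
    rw [fstPos_sub_proj_sepVec, sepVec_eq_smul_impactVec hε.ne' (γ t) t p.1 p.2, norm_smul, Real.norm_eq_abs,
      abs_of_pos hε, norm_impactVec_eq_one hε t hp, mul_one] at h
    have hs : ∑ l, Torus.partialDeriv l φ c.fstPos * (ε • c.impactVec) l = ε * A := by
      rw [hA, Finset.mul_sum]
      exact Finset.sum_congr rfl fun l _ => by rw [PiLp.smul_apply, smul_eq_mul]; ring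
    rwa [hs] at h
  have hC₂ε : 0 ≤ C₂ * ε ^ 2 := (abs_nonneg R).trans hRle
  have hω1 : ∀ k, |c.impactVec k| ≤ 1 := fun k => by
    have h : |c.impactVec k| ≤ ‖c.impactVec‖ := by simpa using PiLp.norm_apply_le c.impactVec k
    exact h.trans_eq (norm_impactVec_eq_one hε t hp)
  have hrad := postVel_fst_sub_preVel_fst_apply hε hγ hp
  have hen := energy_jump_eq hε hγ hp
  refine ⟨fun k => ?_, ?_⟩
  · have hid : payload φ (some k) c - ε * (A * c.impactVec k * ‖c.postVel.1 - c.preVel.1‖) =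
        R * (‖c.postVel.1 - c.preVel.1‖ * c.impactVec k) := by
      simp only [payload, hR]
      rw [hrad k]
      ring
    rw [hid, abs_mul, abs_mul, abs_norm]
    calc |R| * (‖c.postVel.1 - c.preVel.1‖ * |c.impactVec k|) ≤ C₂ * ε ^ 2 * (impulse c * 1) :=
          mul_le_mul hRle (mul_le_mul (norm_sub_le_impulse c) (hω1 k) (abs_nonneg _)
            (AdaptedClampKinematics.impulse_nonneg c)) (by positivity) hC₂ε
      _ = C₂ * ε ^ 2 * impulse c := by rw [mul_one]
  · have hid : payload φ none c -
        ε * (A * (∑ l, ((2 : ℝ)⁻¹ • (c.postVel.1 + c.postVel.2)) l * c.impactVec l) *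
          ‖c.postVel.1 - c.preVel.1‖) =
        R * ((‖c.postVel.1‖ ^ 2 - ‖c.preVel.1‖ ^ 2) / 2) := by
      simp only [payload, hR]
      rw [hen]
      ring
    rw [hid, abs_mul, abs_div, abs_two]
    calc |R| * (|‖c.postVel.1‖ ^ 2 - ‖c.preVel.1‖ ^ 2| / 2) ≤ C₂ * ε ^ 2 * impulse c :=
          mul_le_mul hRle (abs_energy_le_impulse c) (by positivity) hC₂ε

end CollisionDecomposition

end RadialVirial

/-- **Registered sub-goal anchoring this file**: along a hard-sphere trajectory on `𝕋³` the velocity jump of the first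
partner of an ordered contact record is radial and outgoing, `v_fst⁺ - v_fst⁻ = ‖v_fst⁺ - v_fst⁻‖ • ω̂`. -/
theorem collisionDecomposition_radial_jump {N : ℕ} {ε : ℝ} (hε : 0 < ε) {γ : ℝ → Phase N}
    (hγ : IsHardSphereTrajectory (Torus.geometry (Fin 3)) ε (N + 1) γ) {t : ℝ} {p : Fin (N + 1) × Fin (N + 1)}
    (hp : p ∈ contactPairs (Torus.geometry (Fin 3)) ε (γ t)) :
    (HardSphereCollisionRecord.ofConfig (Torus.geometry (Fin 3)) ε (γ t) t p.1 p.2).postVel.1 -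
        (HardSphereCollisionRecord.ofConfig (Torus.geometry (Fin 3)) ε (γ t) t p.1 p.2).preVel.1 =
      ‖(HardSphereCollisionRecord.ofConfig (Torus.geometry (Fin 3)) ε (γ t) t p.1 p.2).postVel.1 -
          (HardSphereCollisionRecord.ofConfig (Torus.geometry (Fin 3)) ε (γ t) t p.1 p.2).preVel.1‖ •
        (HardSphereCollisionRecord.ofConfig (Torus.geometry (Fin 3)) ε (γ t) t p.1 p.2).impactVec :=
  RadialVirial.CollisionDecomposition.postVel_fst_sub_preVel_fst hε hγ hp

end Summit.AtomisticToContinuum.HydrodynamicLimit.Theorems.ClampedTransferCoin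

end
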